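import Literature.Probability.Percolation.KozmaNitzanScheme
import Summits.CriticalPhenomena.PercolationContinuityZ3.Theorems.Transplant.KNLevelsDefs
import HarnessLib

/-!
# F8 (generic), part 1 — Kozma–Nitzan's exploration process over an ANCHORED CELL GEOMETRY of any locally finite graph: the geometry,
# the examination of one macro-edge and its locality (BLUEPRINT-I-PHI §1 `Cells`/`KSch`, §3 Φ11, §5 frames; generalises
# `L/KozmaNitzanScheme.lean` ll. 737–975 from `zdGraph d` to a graph `G` with cells indexed by macro data AND an anchor;
# design memo HOME/prim-bschramm-p2-g2/F8-DESIGN.md)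

builds on p205010 (kernel theorem, internal audit signed; external expert review pending) — nothing in this file uses p205010.
Lane `prim-bschramm`, seat `prim-bschramm-p2` (task F8, lead V38); helper file (`--supports stmt-CriticalPhenomena-4575`).

Kozma–Nitzan's process (arXiv:2401.12397 §4 pp. 25–27) explores the cluster of the origin cell by cell along the square macro-lattice; its
cells `Q_v`, targets `M_x`, edge regions `E_{v,x} = Btw ∪ Q_x` and stubs `H^j_{v,x}` are translates of fixed boxes of `ℤ^d`.  On a graph
with a planar skeleton (`X □ ℤ²`) the process must run in MOVING FRAMES (BLUEPRINT §5, P5 §13 (I-c′)): the fibre window of the cell of `v`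
is centred where the cluster ENTERED `v`.  So every cell set is indexed by an ANCHOR `a : A` besides the macro data; the arrival anchor of
`v` (for `Q_v`, `M_v`, `Cell_v`) is the departure anchor of its parent, and the departure anchor of `v` (for `Btw_{v,x}`, `Efar_{v,x}`,
`H^j_{v,x}`) is computed INSIDE the examination of `v` from the observed open edges by the re-centring rule `anchor`, exactly as KN's level
`j_x` is (adaptive probing).  KN's marker test (29) (`cen x ∈ E_i`) becomes the planar column test `E_i ∩ col x ≠ ∅`.  `ℤ^d`: `A = Unit`.
* §1 `CellGeom V A`, `vspan`; §2 `KSchA V A` and, verbatim from the original with the anchor threaded: `U₀`, `F`, `Vx` (KN's `E_i`),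
  `ξ`, `onward`, `seen`/`depA` (departure anchor read off the observation), `Sx`, `Fj`, `pat`, `Wt`, `Conn`, `cond` ((30)), `jOf`,
  `newRegion`, `envRegion` (over ALL admissible departure anchors), `env`, `revealOf`, `succA`; §3 locality (`depA_congr`, `jOf_congr`,
  `revealOf_congr`, `succA_congr`).  The probe / replay / validity / scheme are part 2 (`KNCellsProcess`).
NO geometric axiom (containment / disjointness / separation) is assumed; downstream files take the named facts they use as hypotheses.

[cite: KozmaNitzan2024, §4 pp. 25–29 ((29)–(32)), Figure 3 — the ℤ^d model] [cite: GrimmettPercolation1999, §7.2]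
-/

noncomputable section

open MeasureTheory ProbabilityTheory
open scoped ENNReal Classical

namespace Summit.CriticalPhenomena.PercolationContinuityZ3.Theorems

namespace Transplant

namespace KNCells

open Literature.Probability.Percolation Literature.Probability.LatticeModels SimpleGraph GadgetSystem ProbeHistory
open Literature.Probability.Percolation.KozmaNitzan (opens jIdx jIdx_lt jIdx_congr)

variable {V : Type*} [DecidableEq V]

/-! ## §1 Anchored cell geometries -/

/-- The vertices spanned by a finite set of pairs (generalises `KozmaNitzan.span` from `Site d`). [folklore] -/
def vspan (F : Finset (Sym2 V)) : Finset V := F.biUnion Sym2.toFinset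

/-- Membership in the span. [folklore] -/
theorem mem_vspan_iff {F : Finset (Sym2 V)} {y : V} : y ∈ vspan F ↔ ∃ e ∈ F, y ∈ e := by
  simp [vspan, Sym2.mem_toFinset]

/-- The span is monotone. [folklore] -/
theorem vspan_mono {F F' : Finset (Sym2 V)} (h : F ⊆ F') : vspan F ⊆ vspan F' := fun y hy => by
  rw [mem_vspan_iff] at hy ⊢; obtain ⟨e, he, hye⟩ := hy; exact ⟨e, h he, hye⟩

/-- **Anchored cell geometry** on the vertex type `V` with anchor type `A` (KN pp. 25–26 with BLUEPRINT §5's frames): the number `K` of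
stub levels, the root vertex (KN's origin) and the root anchor; the cube `Q`, the target cube `M` and the cell of a macro-vertex, anchored;
the between-box `Btw`, the one-box form `Efar` of `E_{v,x}`, the stubs `H^j_{v,x}` and the stub zones of a directed macro-edge, anchored at
the source's departure anchor; the planar column `col x` of a macro cell (marker for (29)); the re-centring rule `anchor` (departure
anchor of `v` from its arrival anchor and the open edges seen) with its finite range `anchSet`; and the three structural facts used to
build the probe.  `ℤ^d`: `A = Unit`, `Q _ v = Cells.Q v`, …, `col x = Q_x`, `K = Cells.K`.  `X □ ℤ²`: `A = W`, `Q a v = B_X(a, R_Q) ×ˢ square`.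
[cite: KozmaNitzan2024, §4 pp. 25–26 (Q_v, M_v, E_{v,x}, H^j_{v,x})] -/
structure CellGeom (V A : Type*) where
  /-- the number of stub levels (KN's `K`) -/
  K : ℕ
  /-- the root vertex (KN's origin `0`) -/
  root : V
  /-- the anchor of the root cell -/
  a₀ : A
  /-- the cube `Q_v`, anchored -/
  Q : A → Site 2 → Finset V
  /-- the target cube `M_v ⊆ Q_v`, anchored -/
  M : A → Site 2 → Finset V
  /-- the cell of `v` (contains `Q_v` and the near halves of its edge regions), anchored -/
  Cell : A → Site 2 → Finset V
  /-- the between-box of the directed macro-edge `(v, δ)`, anchored at the departure anchor of `v` -/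
  Btw : A → Site 2 → MDir → Finset V
  /-- `E_{v,x}` as one box (`⊆ Btw ∪ Q_x`), anchored at the departure anchor of `v` -/
  Efar : A → Site 2 → MDir → Finset V
  /-- the stub `H^j_{v,x}`, anchored at the departure anchor of `v` -/
  Stub : A → Site 2 → MDir → ℕ → Finset V
  /-- the stub zone of `(v, δ)` inside the cell of `v + δ`, anchored at the departure anchor of `v` -/
  Zone : A → Site 2 → MDir → Finset V
  /-- the planar column of the macro cell `x` (KN (29): `x` is determined iff the explored region meets it) -/
  col : Site 2 → Set V
  /-- the re-centring rule: departure anchor of `v` from (arrival anchor, `v`, open edges seen) -/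
  anchor : A → Site 2 → Finset (Sym2 V) → A
  /-- the finite range of the re-centring rule -/
  anchSet : A → Site 2 → Finset A
  /-- the rule lands in its range -/
  anchor_mem : ∀ a v P, anchor a v P ∈ anchSet a v
  /-- stubs grow with the level -/
  stub_mono : ∀ a v δ {j j' : ℕ}, j ≤ j' → Stub a v δ j ⊆ Stub a v δ j'
  /-- at least one stub level -/
  hK : 1 ≤ K

namespace CellGeom

variable {A : Type*} (Γ : CellGeom V A)

omit [DecidableEq V] in
/-- `E_{v,x} = Btw ∪ Q_x`, the cube of the target anchored at the SAME anchor (it becomes the arrival anchor of `x`).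
[cite: KozmaNitzan2024, §4 p. 26 (E_{v,x})] -/
def Ewv (a : A) (v : Site 2) (δ : MDir) : Finset V := Γ.Btw a v δ ∪ Γ.Q a (v + stepVec δ)

omit [DecidableEq V] in
/-- **The cover of a set of macro-vertices** with given arrival / departure anchors: their cells and stub zones. [folklore] -/
def Cover (arr dep : Site 2 → A) (det : Set (Site 2)) : Set V :=
  ⋃ u ∈ det, ((↑(Γ.Cell (arr u) u) : Set V) ∪ ⋃ δ : MDir, ↑(Γ.Zone (dep u) u δ))

end CellGeom

/-! ## §2 The anchored scheme: parameters and the examination of one macro-edge -/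

/-- **The parameters of the anchored exploration process** over `G`: an anchored cell geometry, the percolation parameter `p` and the
threshold `δ` of (30)/(32). [cite: KozmaNitzan2024, §4 pp. 25–27] -/
structure KSchA (V A : Type*) where
  /-- the anchored cells -/
  Γ : CellGeom V A
  /-- the percolation parameter -/
  p : unitInterval
  /-- the threshold `δ` of (30), (32) -/
  δc : ℝ

namespace KSchA

variable {A : Type*} (G : SimpleGraph V) [G.LocallyFinite] (S : KSchA V A)

/-- The initial edges: the edges of `G` inside the root cube `Q_0` (anchored at the root anchor). [cite: KozmaNitzan2024, §4 p. 27] -/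
def U₀ : Finset (Sym2 V) := edgesIn G (S.Γ.Q S.Γ.a₀ 0)

/-- The explored edges after a history: `U₀` and everything revealed. [cite: KozmaNitzan2024, §4 p. 26 (ω|_{E_i})] -/
def F (h : ProbeHistory V) : Finset (Sym2 V) := S.U₀ G ∪ supp h

/-- **The explored region `E_i`**: the vertex span of the explored edges. [cite: KozmaNitzan2024, §4 p. 26 (E_i)] -/
def Vx (h : ProbeHistory V) : Finset V := vspan (S.F G h)

/-- The recorded pattern on the explored edges (`U₀` all open). [cite: KozmaNitzan2024, §4 p. 26 (ω|_{E_i})] -/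
def ξ (h : ProbeHistory V) : Finset (Sym2 V) := S.U₀ G ∪ opens h

/-- **The onward directions** out of `v`: those neighbours `x` whose planar column is unexplored (KN (29) in column form).
[cite: KozmaNitzan2024, §4 p. 27 (X = X_v), p. 26 (29)] -/
def onward (h : ProbeHistory V) (v : Site 2) : Finset MDir :=
  Finset.univ.filter fun du => ∀ y ∈ S.Vx G h, y ∉ S.Γ.col (v + stepVec du)

/-- The conditioned edges that do not depend on the stub level: the edges of `G` inside `E_i ∪ E_{w,v}`. [cite: KozmaNitzan2024, §4 p. 27] -/
def baseF (h : ProbeHistory V) (e : Site 2 × MDir) (a : A) : Finset (Sym2 V) := edgesIn G (S.Vx G h ∪ S.Γ.Ewv a e.1 e.2)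

/-- The open edges seen after revealing `E_{w,v}`: the recorded pattern and the observation on the new edges of `E_i ∪ E_{w,v}`. [folklore] -/
def seen (h : ProbeHistory V) (e : Site 2 × MDir) (a : A) (o : Finset (Sym2 V)) : Finset (Sym2 V) :=
  S.ξ G h ∪ (o ∩ (S.baseF G h e a \ S.F G h))

/-- **The departure anchor of the examined vertex `v = tgt e`**, read off the observation by the re-centring rule (BLUEPRINT §5: the entry
frame). [cite: KozmaNitzan2024, §4 p. 27] -/
def depA (h : ProbeHistory V) (e : Site 2 × MDir) (a : A) (o : Finset (Sym2 V)) : A := S.Γ.anchor a (tgt e) (S.seen G h e a o)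

/-- The support of the examination of the connection `v–x` (`E_i ∪ E_{w,v} ∪ E_{v,x}`). [cite: KozmaNitzan2024, §4 p. 27 ((30))] -/
def Sx (h : ProbeHistory V) (e : Site 2 × MDir) (a a' : A) (du : MDir) : Finset V :=
  S.Vx G h ∪ S.Γ.Ewv a e.1 e.2 ∪ S.Γ.Efar a' (tgt e) du

/-- The conditioned edges at stub level `j` (`D = E_i ∪ E_{w,v} ∪ H^j_{v,x}`). [cite: KozmaNitzan2024, §4 p. 27 ((30): D)] -/
def Fj (h : ProbeHistory V) (e : Site 2 × MDir) (a a' : A) (du : MDir) (j : ℕ) : Finset (Sym2 V) :=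
  edgesIn G (S.Vx G h ∪ S.Γ.Ewv a e.1 e.2 ∪ S.Γ.Stub a' (tgt e) du j)

/-- The pattern pinned at level `j`: the recorded one on the explored edges, the observed one `o` on the new edges.
[cite: KozmaNitzan2024, §4 p. 27 ((30): ω|_D)] -/
def pat (h : ProbeHistory V) (e : Site 2 × MDir) (a a' : A) (du : MDir) (j : ℕ) (o : Finset (Sym2 V)) : Finset (Sym2 V) :=
  S.ξ G h ∪ (o ∩ (S.Fj G h e a a' du j \ S.F G h))

/-- **The weighting of (30)**: the graph weighting pinned on `ω|_D` and restricted to `D ∪ E_{v,x}`. [cite: KozmaNitzan2024, §4 p. 27 ((30))] -/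
def Wt (h : ProbeHistory V) (e : Site 2 × MDir) (a a' : A) (du : MDir) (j : ℕ) (o : Finset (Sym2 V)) : Sym2 V → unitInterval :=
  restrW (↑(S.Sx G h e a a' du) : Set V) (pinW (KNLevels.lattW G S.p) ↑(S.Fj G h e a a' du j) ↑(S.pat G h e a a' du j o))

omit [DecidableEq V] in
/-- The target event `{root ↔ M_x}`, `M_x` anchored at the departure anchor of `v` (= the arrival anchor of `x`).
[cite: KozmaNitzan2024, §4 p. 27 ((30): 0 ↔ M_x)] -/
def Conn (a' : A) (e : Site 2 × MDir) (du : MDir) : Set (BondConfig V) :=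
  ⋃ t ∈ S.Γ.M a' (tgt e + stepVec du), openConn S.Γ.root t

/-- **(30)**: the connection `v–x` is good at level `j` given the observation `o`. [cite: KozmaNitzan2024, §4 p. 27 ((30))] -/
def cond (h : ProbeHistory V) (e : Site 2 × MDir) (a a' : A) (du : MDir) (j : ℕ) (o : Finset (Sym2 V)) : Prop :=
  1 - S.δc < (prodBernoulli (S.Wt G h e a a' du j o)).real (S.Conn a' e du)

/-- `j_x`: the first good level, or `K - 1`. [cite: KozmaNitzan2024, §4 p. 27 (j_x)] -/
def jOf (h : ProbeHistory V) (e : Site 2 × MDir) (a a' : A) (du : MDir) (o : Finset (Sym2 V)) : ℕ :=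
  jIdx S.Γ.K fun j => S.cond G h e a a' du j o

/-- The region revealed by the examination, given the observation (`E_{w,v} ∪ ⋃_x H^{j_x}_{v,x}`, stubs at the departure anchor).
[cite: KozmaNitzan2024, §4 p. 27 (E_{i+1})] -/
def newRegion (h : ProbeHistory V) (e : Site 2 × MDir) (a a' : A) (o : Finset (Sym2 V)) : Finset V :=
  S.Γ.Ewv a e.1 e.2 ∪ (S.onward G h (tgt e)).biUnion fun du => S.Γ.Stub a' (tgt e) du (S.jOf G h e a a' du o)

/-- The envelope region (`E_{w,v} ∪` the longest stubs at EVERY admissible departure anchor). [cite: KozmaNitzan2024, §4 p. 27] -/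
def envRegion (h : ProbeHistory V) (e : Site 2 × MDir) (a : A) : Finset V :=
  S.Γ.Ewv a e.1 e.2 ∪ (S.Γ.anchSet a (tgt e)).biUnion fun a' =>
    (S.onward G h (tgt e)).biUnion fun du => S.Γ.Stub a' (tgt e) du (S.Γ.K - 1)

/-- The envelope of the examination: the fresh edges of `G` inside `E_i ∪` envelope region. [cite: KozmaNitzan2024, §4 p. 27] -/
def env (h : ProbeHistory V) (e : Site 2 × MDir) (a : A) : Finset (Sym2 V) :=
  edgesIn G (S.Vx G h ∪ S.envRegion G h e a) \ S.F G h

/-- The revealed edges given the observation: the fresh edges of `G` inside `E_i ∪` new region, the departure anchor read off `o`.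
[cite: KozmaNitzan2024, §4 p. 27 (E_{i+1})] -/
def revealOf (h : ProbeHistory V) (e : Site 2 × MDir) (a : A) (o : Finset (Sym2 V)) : Finset (Sym2 V) :=
  edgesIn G (S.Vx G h ∪ S.newRegion G h e a (S.depA G h e a o) o) \ S.F G h

/-- **Success** at source anchor `a` ("declare `v` good … if all connections to all `x ∈ X` are good", with the stubs and targets at
the departure anchor read off the observation). [cite: KozmaNitzan2024, §4 p. 27] -/
def succA (h : ProbeHistory V) (e : Site 2 × MDir) (a : A) (o : Finset (Sym2 V)) : Prop :=
  ∀ du ∈ S.onward G h (tgt e), S.cond G h e a (S.depA G h e a o) du (S.jOf G h e a (S.depA G h e a o) du o) o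

/-! ## §3 Locality -/

variable {G}

/-- `j_x < K`. [folklore] -/
theorem jOf_lt (h : ProbeHistory V) (e : Site 2 × MDir) (a a' : A) (du : MDir) (o : Finset (Sym2 V)) :
    S.jOf G h e a a' du o < S.Γ.K :=
  jIdx_lt S.Γ.hK _

/-- `E_{w,v}` lies in the new region. [folklore] -/
theorem Ewv_subset_newRegion (h : ProbeHistory V) (e : Site 2 × MDir) (a a' : A) (o : Finset (Sym2 V)) :
    S.Γ.Ewv a e.1 e.2 ⊆ S.newRegion G h e a a' o := Finset.subset_union_left

/-- The new region lies in the envelope region (the departure anchor being admissible). [folklore] -/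
theorem newRegion_subset_envRegion (h : ProbeHistory V) (e : Site 2 × MDir) (a : A) {a' : A}
    (ha' : a' ∈ S.Γ.anchSet a (tgt e)) (o : Finset (Sym2 V)) :
    S.newRegion G h e a a' o ⊆ S.envRegion G h e a := by
  intro y hy
  rcases Finset.mem_union.1 hy with hy | hy
  · exact Finset.mem_union_left _ hy
  · refine Finset.mem_union_right _ (Finset.mem_biUnion.2 ⟨a', ha', ?_⟩)
    rw [Finset.mem_biUnion] at hy ⊢
    obtain ⟨du, hdu, hy⟩ := hy
    exact ⟨du, hdu, S.Γ.stub_mono _ _ _ (by have := S.jOf_lt (G := G) h e a a' du o; omega) hy⟩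

/-- The new edges of `E_i ∪ E_{w,v}` are revealed (whatever the departure anchor). [folklore] -/
theorem baseF_sdiff_subset_revealOf (h : ProbeHistory V) (e : Site 2 × MDir) (a : A) (o : Finset (Sym2 V)) :
    S.baseF G h e a \ S.F G h ⊆ S.revealOf G h e a o := by
  refine Finset.sdiff_subset_sdiff ?_ le_rfl
  intro x hx
  rw [baseF, mem_edgesIn_iff] at hx
  rw [mem_edgesIn_iff]
  refine ⟨hx.1, fun y hy => ?_⟩
  rcases Finset.mem_union.1 (hx.2 y hy) with h' | h'
  · exact Finset.mem_union_left _ h'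
  · exact Finset.mem_union_right _ (S.Ewv_subset_newRegion h e a _ o h')

/-- The revealed edges lie in the envelope. [folklore] -/
theorem revealOf_subset_env (h : ProbeHistory V) (e : Site 2 × MDir) (a : A) (o : Finset (Sym2 V)) :
    S.revealOf G h e a o ⊆ S.env G h e a := by
  refine Finset.sdiff_subset_sdiff ?_ le_rfl
  intro x hx
  rw [mem_edgesIn_iff] at hx ⊢
  refine ⟨hx.1, fun y hy => ?_⟩
  rcases Finset.mem_union.1 (hx.2 y hy) with h' | h'
  · exact Finset.mem_union_left _ h'
  · exact Finset.mem_union_right _ (S.newRegion_subset_envRegion h e a (S.Γ.anchor_mem _ _ _) o h')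

/-- The conditioned edges at level `j ≤ j'` lie among those at level `j'`. [folklore] -/
theorem Fj_mono (h : ProbeHistory V) (e : Site 2 × MDir) (a a' : A) (du : MDir) {j j' : ℕ} (hjj' : j ≤ j') :
    S.Fj G h e a a' du j ⊆ S.Fj G h e a a' du j' := by
  intro x hx
  rw [Fj, mem_edgesIn_iff] at hx ⊢
  refine ⟨hx.1, fun y hy => ?_⟩
  rcases Finset.mem_union.1 (hx.2 y hy) with h' | h'
  · exact Finset.mem_union_left _ h'
  · exact Finset.mem_union_right _ (S.Γ.stub_mono _ _ _ hjj' h')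

/-- The level-independent conditioned edges lie among those at every level. [folklore] -/
theorem baseF_subset_Fj (h : ProbeHistory V) (e : Site 2 × MDir) (a a' : A) (du : MDir) (j : ℕ) :
    S.baseF G h e a ⊆ S.Fj G h e a a' du j := by
  intro x hx
  rw [baseF, mem_edgesIn_iff] at hx
  rw [Fj, mem_edgesIn_iff]
  exact ⟨hx.1, fun y hy => Finset.mem_union_left _ (hx.2 y hy)⟩

/-- The explored edges lie among the conditioned edges (when they are the edges inside the explored region). [folklore] -/
theorem F_subset_Fj {h : ProbeHistory V} (hF : S.F G h = edgesIn G (S.Vx G h))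
    (e : Site 2 × MDir) (a a' : A) (du : MDir) (j : ℕ) : S.F G h ⊆ S.Fj G h e a a' du j := by
  rw [hF]
  intro x hx
  rw [mem_edgesIn_iff] at hx
  rw [Fj, mem_edgesIn_iff]
  exact ⟨hx.1, fun y hy => Finset.mem_union_left _ (Finset.mem_union_left _ (hx.2 y hy))⟩

/-- The new conditioned edges at level `j ≤ j_x` of an onward direction are revealed (departure anchor read off `o`). [folklore] -/
theorem Fj_sdiff_subset_revealOf {h : ProbeHistory V} {e : Site 2 × MDir} {a : A} {du : MDir}
    (hdu : du ∈ S.onward G h (tgt e)) {o : Finset (Sym2 V)} {j : ℕ}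
    (hj : j ≤ S.jOf G h e a (S.depA G h e a o) du o) :
    S.Fj G h e a (S.depA G h e a o) du j \ S.F G h ⊆ S.revealOf G h e a o := by
  refine Finset.sdiff_subset_sdiff ?_ le_rfl
  intro x hx
  rw [Fj, mem_edgesIn_iff] at hx
  rw [mem_edgesIn_iff]
  refine ⟨hx.1, fun y hy => ?_⟩
  rcases Finset.mem_union.1 (hx.2 y hy) with h' | h'
  · rcases Finset.mem_union.1 h' with h'' | h''
    · exact Finset.mem_union_left _ h''
    · exact Finset.mem_union_right _ (Finset.mem_union_left _ h'')
  · refine Finset.mem_union_right _ (Finset.mem_union_right _ ?_)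
    exact Finset.mem_biUnion.2 ⟨du, hdu, S.Γ.stub_mono _ _ _ hj h'⟩

/-- The new conditioned edges of an onward direction, at an admissible departure anchor, lie in the envelope. [folklore] -/
theorem Fj_sdiff_subset_env (h : ProbeHistory V) (e : Site 2 × MDir) (a : A) {a' : A} (ha' : a' ∈ S.Γ.anchSet a (tgt e))
    {du : MDir} (hdu : du ∈ S.onward G h (tgt e)) {j : ℕ} (hj : j < S.Γ.K) :
    S.Fj G h e a a' du j \ S.F G h ⊆ S.env G h e a := by
  refine Finset.sdiff_subset_sdiff ?_ le_rfl
  intro x hx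
  rw [Fj, mem_edgesIn_iff] at hx
  rw [mem_edgesIn_iff]
  refine ⟨hx.1, fun y hy => ?_⟩
  rcases Finset.mem_union.1 (hx.2 y hy) with h' | h'
  · rcases Finset.mem_union.1 h' with h'' | h''
    · exact Finset.mem_union_left _ h''
    · exact Finset.mem_union_right _ (Finset.mem_union_left _ h'')
  · refine Finset.mem_union_right _ (Finset.mem_union_right _ ?_)
    exact Finset.mem_biUnion.2 ⟨a', ha', Finset.mem_biUnion.2 ⟨du, hdu, S.Γ.stub_mono _ _ _ (by omega) h'⟩⟩

/-- **Locality of the departure anchor**: observations agreeing on the new edges of `E_i ∪ E_{w,v}` give the same departure anchor. [folklore] -/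
theorem depA_congr (h : ProbeHistory V) (e : Site 2 × MDir) (a : A) {o o' : Finset (Sym2 V)}
    (hoo' : ∀ x ∈ S.baseF G h e a \ S.F G h, x ∈ o ↔ x ∈ o') : S.depA G h e a o' = S.depA G h e a o := by
  unfold depA seen
  congr 2; ext x; simp only [Finset.mem_inter]
  exact ⟨fun ⟨hx, hx'⟩ => ⟨(hoo' x hx').2 hx, hx'⟩, fun ⟨hx, hx'⟩ => ⟨(hoo' x hx').1 hx, hx'⟩⟩

/-- The pattern only depends on the observation on the new conditioned edges. [folklore] -/
theorem pat_congr (h : ProbeHistory V) (e : Site 2 × MDir) (a a' : A) (du : MDir) (j : ℕ) {o o' : Finset (Sym2 V)}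
    (hoo' : ∀ x ∈ S.Fj G h e a a' du j \ S.F G h, x ∈ o ↔ x ∈ o') :
    S.pat G h e a a' du j o = S.pat G h e a a' du j o' := by
  unfold pat
  congr 1; ext x; simp only [Finset.mem_inter]
  exact ⟨fun ⟨hx, hx'⟩ => ⟨(hoo' x hx').1 hx, hx'⟩, fun ⟨hx, hx'⟩ => ⟨(hoo' x hx').2 hx, hx'⟩⟩

/-- Hence so does the good-connection predicate. [folklore] -/
theorem cond_congr (h : ProbeHistory V) (e : Site 2 × MDir) (a a' : A) (du : MDir) (j : ℕ) {o o' : Finset (Sym2 V)}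
    (hoo' : ∀ x ∈ S.Fj G h e a a' du j \ S.F G h, x ∈ o ↔ x ∈ o') :
    S.cond G h e a a' du j o ↔ S.cond G h e a a' du j o' := by
  unfold cond Wt
  rw [S.pat_congr h e a a' du j hoo']

/-- **Locality of `j_x`** at a fixed departure anchor: observations agreeing on the new conditioned edges up to level `j_x(o)` give the same
`j_x` and the same goodness at `j_x`. [folklore] -/
theorem jOf_congr_of {h : ProbeHistory V} {e : Site 2 × MDir} {a a' : A} {du : MDir} {o o' : Finset (Sym2 V)}
    (hoo' : ∀ j ≤ S.jOf G h e a a' du o, ∀ x ∈ S.Fj G h e a a' du j \ S.F G h, x ∈ o ↔ x ∈ o') :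
    S.jOf G h e a a' du o' = S.jOf G h e a a' du o ∧
      (S.cond G h e a a' du (S.jOf G h e a a' du o) o' ↔ S.cond G h e a a' du (S.jOf G h e a a' du o) o) := by
  have key : ∀ j ≤ S.jOf G h e a a' du o, (S.cond G h e a a' du j o ↔ S.cond G h e a a' du j o') := fun j hj =>
    S.cond_congr h e a a' du j (hoo' j hj)
  exact ⟨jIdx_congr key, (key _ le_rfl).symm⟩

/-- **Locality of `j_x`**: observations agreeing on the revealed edges give the same departure anchor, the same `j_x` and the same
goodness at `j_x`, for every onward direction. [folklore] -/
theorem jOf_congr {h : ProbeHistory V} {e : Site 2 × MDir} {a : A} {du : MDir} (hdu : du ∈ S.onward G h (tgt e))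
    {o o' : Finset (Sym2 V)} (hoo' : ∀ x ∈ S.revealOf G h e a o, x ∈ o ↔ x ∈ o') :
    S.jOf G h e a (S.depA G h e a o') du o' = S.jOf G h e a (S.depA G h e a o) du o ∧
      (S.cond G h e a (S.depA G h e a o') du (S.jOf G h e a (S.depA G h e a o) du o) o' ↔
        S.cond G h e a (S.depA G h e a o) du (S.jOf G h e a (S.depA G h e a o) du o) o) := by
  have hdep : S.depA G h e a o' = S.depA G h e a o :=
    S.depA_congr h e a fun x hx => hoo' x (S.baseF_sdiff_subset_revealOf h e a o hx)
  rw [hdep]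
  exact S.jOf_congr_of fun j hj x hx => hoo' x (S.Fj_sdiff_subset_revealOf hdu hj hx)

/-- **Locality of the revealed set.** [folklore] -/
theorem revealOf_congr {h : ProbeHistory V} {e : Site 2 × MDir} {a : A} {o o' : Finset (Sym2 V)}
    (hoo' : ∀ x ∈ S.revealOf G h e a o, x ∈ o ↔ x ∈ o') : S.revealOf G h e a o' = S.revealOf G h e a o := by
  have hdep : S.depA G h e a o' = S.depA G h e a o :=
    S.depA_congr h e a fun x hx => hoo' x (S.baseF_sdiff_subset_revealOf h e a o hx)
  unfold revealOf newRegion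
  rw [hdep]
  have : ∀ du ∈ S.onward G h (tgt e), S.jOf G h e a (S.depA G h e a o) du o' = S.jOf G h e a (S.depA G h e a o) du o :=
    fun du hdu => by have := (S.jOf_congr hdu hoo').1; rwa [hdep] at this
  rw [Finset.biUnion_congr rfl fun du hdu => by rw [this du hdu]]

/-- **Locality of success.** [folklore] -/
theorem succA_congr {h : ProbeHistory V} {e : Site 2 × MDir} {a : A} {o o' : Finset (Sym2 V)}
    (hoo' : ∀ x ∈ S.revealOf G h e a o, x ∈ o ↔ x ∈ o') : S.succA G h e a o' ↔ S.succA G h e a o := by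
  unfold succA
  refine forall₂_congr fun du hdu => ?_
  obtain ⟨h1, h2⟩ := S.jOf_congr hdu hoo'
  rw [h1, h2]

end KSchA

end KNCells

end Transplant

end Summit.CriticalPhenomena.PercolationContinuityZ3.Theorems

end
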